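import Summits.AnomalousDissipation.AnomalousDissipation.Theorems.MomentParityMomentLadderOneTrajectory
import Summits.AnomalousDissipation.AnomalousDissipation.Theorems.MomentParityMomentLadderLineConverse

/-!
# Line `Sketch` (card `enstrophy-ui-resolution`) — crux `MomentParity.MomentLadder` (stmt-AnomalousDissipation-11463):
# skeleton after the ONE-TRAJECTORY RESHAPE (continuation lead c1, 2026-08-16)

History. Leads -0 and -1 landed all ten stubs of the UI skeleton but C⁺ and proved the residual EXACT:
`galerkinInvariantLoudUI_iff_MomentLadder` (C⁺ ↔ crux), `galerkinInvariantLoud_of_MomentLadder` (crux ⇒ sibling crux 14283),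
`MomentLadder_of_oneTrajectoryUI` (trajectory corner, UI-modulus form). Lead c1 moved the ONE open stub onto the currency in
which the sibling crux `GalerkinInvariantLoud` keeps its own open stub (`stub_oneTrajectoryTaylor`, line
`taylor-cone-homogenisation`): ONE Galerkin run per `(j, N)`.

Registered stub (the ONLY `sorry`):
* `stub_oneTrajectoryResolved` (T_res) — `∃ f` smooth div-free mean-zero, `f ≠ 0`, `ν_j → 0⁺`, ONE `κ > 0`; at every `j` a
  LEVEL-FREE schedule `K_j`; for infinitely many `N` ONE mean-zero Galerkin datum `a` of order `N` whose orbit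
  `u = galerkinFlow ν_j f N · a` has (i) cumulative Taylor ratio `liminf_T ν_j∫₀ᵀ‖∇u‖² / ∫₀ᵀ|u|² ≥ κ` — VERBATIM the body of
  14283's `stub_oneTrajectoryTaylor` — and (ii) resolved time-averaged enstrophy: `limsup_T T⁻¹∫₀ᵀ(‖∇u‖² − ‖∇P_{K_j n}u‖²)
  ≤ 1/(n+1)` for all `n` (the converged-DNS clause: no pile-up of the dissipation spectrum at the truncation shell,
  uniformly in the resolution; Kaneda et al. 2003). OPEN — it is the zeroth law for one DNS run per `(ν_j, N)` plus spectral
  convergence; crux-EQUIVALENT (`oneTrajectoryResolved_iff_MomentLadder`, file `…OneTrajectoryConverse.lean`).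
Composition (kernel-checked, no sorry of its own): `momentLadder_of_stubs := MomentLadder_of_oneTrajectoryResolved stub_…`
(landed transfer p98172: Krylov–Bogoliubov with the resolution rows p97429 + energy floor + energy row + `momentLadder_iff`).

Landed by lead c1 (all `--supports stmt-AnomalousDissipation-11463`): `…KBResolved` p97429, `…OneTrajectory` p98172,
`…PhaseLaw` p98921, `…TimeMeans` p99722, `…ErgodicPrelim`, `…Selection`, `…OneTrajectoryConverse` (see NOTES).
Disproof used (`Cruxes/MomentLadder/Disproof.lean`, cycle 1, unchanged, re-read 10:30Z and 11:40Z): no kill, no `-- Targets`;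
load-bearing table respected (κ one number but `K_j`, `R_j` j-dependent; N unbounded inside `∃ᶠ`; `∃ f`, `f ≠ 0`).
-/

set_option linter.dupNamespace false

noncomputable section

namespace Summit.AnomalousDissipation.AnomalousDissipation.Theorems.MomentLadder

open MeasureTheory Filter Topology Set
open scoped ENNReal
open Literature.Analysis.FunctionSpaces Literature.Analysis.FluidPDE
open Summit.AnomalousDissipation.AnomalousDissipation.Theses.MomentParity
open Summit.AnomalousDissipation.AnomalousDissipation.Theorems.QuarticGate.Negative

/-! ## Registered stub (the ONLY sorry of the skeleton) -/

/-- STUB T_res (lead): ONE RESOLVED TAYLOR TRAJECTORY per `(j, N)` — OPEN (the zeroth law for one converged DNS run per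
`(ν_j, N)`, `N`-frequently, with level-uniform spectral convergence); crux-equivalent. -/
theorem stub_oneTrajectoryResolved :
    ∃ f : UnitAddTorus (Fin 3) → EuclideanSpace ℝ (Fin 3),
      Torus.IsSmooth f ∧ Torus.IsDivFree f ∧ Torus.HasZeroMean f ∧ f ≠ 0 ∧
      ∃ (ν : ℕ → ℝ) (κ : ℝ), (∀ j, 0 < ν j) ∧ Tendsto ν atTop (𝓝 0) ∧ 0 < κ ∧
        ∀ j : ℕ, ∃ K : ℕ → ℕ, ∃ᶠ N in atTop, ∃ a : UnitAddTorus (Fin 3) → EuclideanSpace ℝ (Fin 3),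
          IsGalerkinMode N a ∧ Torus.HasZeroMean a ∧
          κ ≤ Filter.liminf (fun T : ℝ =>
            (ν j * (∫⁻ t in Ioo 0 T, Torus.eGradNormSq (Torus.galerkinFlow (ν j) f N t a)).toReal) /
              (∫ t in (0 : ℝ)..T, ∫ x, ‖Torus.galerkinFlow (ν j) f N t a x‖ ^ 2)) atTop ∧
          ∀ n : ℕ, Filter.limsup (fun T : ℝ => (ENNReal.ofReal T)⁻¹ *
            ∫⁻ t in Ioo 0 T, (Torus.eGradNormSq (Torus.galerkinFlow (ν j) f N t a) -
              Torus.eGradNormSq (Torus.fourierTruncate (K n) (Torus.galerkinFlow (ν j) f N t a)))) atTop ≤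
            ((n : ℝ≥0∞) + 1)⁻¹ := by
  sorry

/-! ## Composition (kernel-checked; concludes the crux BY NAME) -/

/-- The skeleton closes the crux modulo its one registered stub: `T_res ⟹ MomentLadder` is the landed transfer
`MomentLadder_of_oneTrajectoryResolved`. -/
theorem momentLadder_of_stubs : MomentLadder :=
  MomentLadder_of_oneTrajectoryResolved stub_oneTrajectoryResolved

/-- The previous residual is recovered: T_res also gives C⁺ (the UI form of the loud rung), through the crux. -/
theorem galerkinInvariantLoudUI_of_stubs :
    ∃ f : UnitAddTorus (Fin 3) → EuclideanSpace ℝ (Fin 3),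
      Torus.IsSmooth f ∧ Torus.IsDivFree f ∧ Torus.HasZeroMean f ∧
      ∃ (ν : ℕ → ℝ) (E ε : ℝ) (Ψ : ℝ≥0∞ → ℝ≥0∞),
        (∀ j, 0 < ν j) ∧ Tendsto ν atTop (𝓝 0) ∧ 0 < ε ∧
        Tendsto (fun x : ℝ≥0∞ => Ψ x / x) (𝓝[≠] ⊤) (𝓝 ⊤) ∧
        ∀ j : ℕ, ∃ (R : ℝ) (B : ℝ≥0∞), B < ⊤ ∧ ∃ᶠ N in atTop,
          ∃ μ : Measure (Torus.energySpace (Fin 3)),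
            IsProbabilityMeasure μ ∧ (∀ᵐ u ∂μ, IsLevel N u) ∧ Negative.IsSupported R μ ∧
            (∀ d, IsPolyStationary (ν j) f N d μ) ∧
            ∫⁻ u, Ψ (Torus.eGradNormSq (u.1 : UnitAddTorus (Fin 3) → EuclideanSpace ℝ (Fin 3))) ∂μ ≤ B ∧
            Torus.ensembleEnergy μ ≤ E ∧ ε ≤ Torus.ensembleDissipation (ν j) μ :=
  galerkinInvariantLoudUI_of_MomentLadder momentLadder_of_stubs

end Summit.AnomalousDissipation.AnomalousDissipation.Theorems.MomentLadder

end
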